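import Mathlib
import HarnessLib
import Literature.Probability.LatticeModels.BrillouinRiemannSumRate

/-!
# Route `KLProgramme` — crux K3, ENGINE child (stmt-HubbardSuperconductivity-19855 `KLRegimeEngineV12`): the torus momentum average of a periodic planar
# function against its integral over the square, at rate `2πK/L` — the lattice ↔ continuum step for the `ℝ × ℝ`-stated bubble estimates
# (cell gate-hubbard-kl, seat hubbard-kl-k3c2-p2)

The forward-bubble estimates `klfb_*/klfs_*/klfp_*` (`…ForwardBubblePlanar` etc.) bound `∫_{ℝ²} h` for planar integrands `h : ℝ × ℝ → ℂ` supported in the open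
square; the model's bubbles are torus momentum averages `L⁻²·Σ_{k ∈ (ℤ/Lℤ)²} F(2πk/L)` of the `2π`-periodic function `F` agreeing with `h` on the square.  The
Literature rate lemma `norm_momentumAverage_sub_integral_le_of_lipschitzOnWith` (grid `[0,2π)^d ⊂ (Fin d → ℝ)`, integral `∫_{[−π,π]^d} G(q + π) dq`) is here
brought to that form: §1 the `(Fin 2 → ℝ) ↔ ℝ × ℝ` transfer and the product-to-iterated rewriting, §2 periodicity of the integral over a period square,
§3 **`klfl_latticeAverage_sub_integral_norm_le`**: for `F` continuous, `2π`-periodic in both coordinates and `K`-Lipschitz (sup metric),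
`‖L⁻²·Σ_k F(2πk₀/L, 2πk₁/L) − (2π)⁻²·∫_{[−π,π]²} F‖ ≤ 2πK/L` for every `L ≥ 1`, and `klfl_latticeAverage_sub_planar_integral_norm_le`: the same against
`(2π)⁻²·∫_{ℝ²} h` when `F = h` on the closed square and `h = 0` off it.  Pure analysis; nothing about the model is asserted.
References: Friedli–Velenik §10.5.2 (10.41); the tree's `BrillouinRiemannSumRate`.
-/

noncomputable section

namespace Summit.HubbardSuperconductivity.HubbardSuperconductivity.Theorems.KLRegimeSplit

set_option linter.dupNamespace false -- summit = problem name (single-conjunct summit), D-0017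

open Real Set MeasureTheory intervalIntegral Literature.Probability.LatticeModels
open scoped NNReal

variable {E : Type*} [NormedAddCommGroup E] [NormedSpace ℝ E] [CompleteSpace E]

/-! ## §1 Transfer `(Fin 2 → ℝ) ↔ ℝ × ℝ` and product-to-iterated -/

/-- The Brillouin zone of `ℤ²` is the preimage of the square under `finTwoArrow`. -/
theorem klfl_brillouin_two_eq_preimage :
    brillouin 2 = (MeasurableEquiv.finTwoArrow : (Fin 2 → ℝ) ≃ᵐ ℝ × ℝ) ⁻¹' (Icc (-π) π ×ˢ Icc (-π) π) := by
  ext q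
  simp only [brillouin, Set.mem_pi, Set.mem_univ, true_implies, Set.mem_preimage, MeasurableEquiv.finTwoArrow_apply,
    Set.mem_prod, Fin.forall_fin_two]

omit [CompleteSpace E] in
/-- **Transfer**: `∫_{[−π,π]²} G(q + π) dq` over `Fin 2 → ℝ` is `∫_{[−π,π]²} F(x + π, y + π)` over `ℝ × ℝ` for `G q = F (q 0, q 1)`. -/
theorem klfl_integral_brillouin_eq_prod (F : ℝ × ℝ → E) :
    ∫ q in brillouin 2, (fun q : Fin 2 → ℝ => F (q 0, q 1)) (fun i => q i + π) =
      ∫ p in Icc (-π) π ×ˢ Icc (-π) π, F (p.1 + π, p.2 + π) := by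
  have hmp := volume_preserving_finTwoArrow ℝ
  rw [klfl_brillouin_two_eq_preimage]
  rw [← hmp.setIntegral_preimage_emb (MeasurableEquiv.finTwoArrow).measurableEmbedding
    (fun p : ℝ × ℝ => F (p.1 + π, p.2 + π)) (Icc (-π) π ×ˢ Icc (-π) π)]
  rfl

omit [CompleteSpace E] in
/-- Product-to-iterated for a continuous integrand on a compact rectangle (`a ≤ b`, `c ≤ d`). -/
theorem klfl_setIntegral_Icc_prod {F : ℝ × ℝ → E} (hF : Continuous F) {a b c d : ℝ} (hab : a ≤ b) (hcd : c ≤ d) :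
    ∫ p in Icc a b ×ˢ Icc c d, F p = ∫ x in a..b, ∫ y in c..d, F (x, y) := by
  have hint : IntegrableOn F (Icc a b ×ˢ Icc c d) (volume.prod volume) :=
    (hF.continuousOn).integrableOn_compact (isCompact_Icc.prod isCompact_Icc)
  have h1 : ∫ p in Icc a b ×ˢ Icc c d, F p = ∫ x in Icc a b, ∫ y in Icc c d, F (x, y) := by
    rw [← Measure.volume_eq_prod] at hint
    have := setIntegral_prod F (μ := volume) (ν := volume) (by rw [← Measure.volume_eq_prod]; exact hint)
    rw [Measure.volume_eq_prod]
    exact this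
  rw [h1, intervalIntegral.integral_of_le hab, setIntegral_congr_set Ioc_ae_eq_Icc.symm]
  refine setIntegral_congr_fun measurableSet_Ioc fun x _ => ?_
  rw [intervalIntegral.integral_of_le hcd, setIntegral_congr_set Ioc_ae_eq_Icc.symm]

/-! ## §2 Periodicity of the integral over a period square -/

omit [CompleteSpace E] in
/-- For `F` `2π`-periodic in both coordinates: `∫_{x∈−π..π}∫_{y∈−π..π} F(x+π, y+π) = ∫_{x∈−π..π}∫_{y∈−π..π} F(x,y)`. -/
theorem klfl_iterated_shift_eq {F : ℝ × ℝ → E} (h1 : ∀ x y, F (x + 2 * π, y) = F (x, y))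
    (h2 : ∀ x y, F (x, y + 2 * π) = F (x, y)) :
    ∫ x in (-π)..π, ∫ y in (-π)..π, F (x + π, y + π) = ∫ x in (-π)..π, ∫ y in (-π)..π, F (x, y) := by
  -- inner: translate then use periodicity in `y`
  have hinner : ∀ x, ∫ y in (-π)..π, F (x + π, y + π) = ∫ y in (-π)..π, F (x + π, y) := by
    intro x
    have hper : Function.Periodic (fun y => F (x + π, y)) (2 * π) := fun y => h2 (x + π) y
    rw [intervalIntegral.integral_comp_add_right (fun y => F (x + π, y)) π]
    have := hper.intervalIntegral_add_eq 0 (-π)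
    simp only [zero_add] at this
    rw [show -π + π = 0 by ring, show π + π = 2 * π by ring, this, show -π + 2 * π = π by ring]
  simp_rw [hinner]
  -- outer: translate then periodicity in `x`
  have hper : Function.Periodic (fun x => ∫ y in (-π)..π, F (x, y)) (2 * π) := fun x => by
    simp only [h1]
  rw [intervalIntegral.integral_comp_add_right (fun x => ∫ y in (-π)..π, F (x, y)) π]
  have := hper.intervalIntegral_add_eq 0 (-π)
  simp only [zero_add] at this
  rw [show -π + π = 0 by ring, show π + π = 2 * π by ring, this, show -π + 2 * π = π by ring]

omit [CompleteSpace E] in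
/-- **The shifted square integral is the square integral** for a continuous doubly `2π`-periodic `F`:
`∫_{[−π,π]²} F(x+π, y+π) = ∫_{[−π,π]²} F`. -/
theorem klfl_setIntegral_shift_eq {F : ℝ × ℝ → E} (hF : Continuous F) (h1 : ∀ x y, F (x + 2 * π, y) = F (x, y))
    (h2 : ∀ x y, F (x, y + 2 * π) = F (x, y)) :
    ∫ p in Icc (-π) π ×ˢ Icc (-π) π, F (p.1 + π, p.2 + π) = ∫ p in Icc (-π) π ×ˢ Icc (-π) π, F p := by
  have hπ : -π ≤ π := by linarith [Real.pi_pos]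
  have hFs : Continuous fun p : ℝ × ℝ => F (p.1 + π, p.2 + π) :=
    hF.comp ((continuous_fst.add continuous_const).prodMk (continuous_snd.add continuous_const))
  rw [klfl_setIntegral_Icc_prod hFs hπ hπ, klfl_setIntegral_Icc_prod hF hπ hπ]
  exact klfl_iterated_shift_eq h1 h2

/-! ## §3 The momentum average against the square / planar integral -/

/-- **THE TORUS MOMENTUM AVERAGE OF A PERIODIC PLANAR FUNCTION VS ITS SQUARE INTEGRAL.**  For `F : ℝ × ℝ → E` continuous, `2π`-periodic in both
coordinates and `K`-Lipschitz in the sup metric (`‖F p − F q‖ ≤ K·dist p q`), and every `L ≥ 1`: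
`‖L⁻²·Σ_{k ∈ (ℤ/Lℤ)²} F(2πk₀/L, 2πk₁/L) − (2π)⁻²·∫_{[−π,π]²} F‖ ≤ 2πK/L`. -/
theorem klfl_latticeAverage_sub_integral_norm_le {F : ℝ × ℝ → E} (hF : Continuous F) (h1 : ∀ x y, F (x + 2 * π, y) = F (x, y))
    (h2 : ∀ x y, F (x, y + 2 * π) = F (x, y)) {K : ℝ≥0} (hlip : ∀ p q : ℝ × ℝ, ‖F p - F q‖ ≤ K * dist p q)
    (L : ℕ) [NeZero L] :
    ‖((L ^ 2 : ℕ) : ℝ)⁻¹ • ∑ k : TorusSite 2 L, F (latticeMomentum L k 0, latticeMomentum L k 1) -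
        ((2 * π) ^ 2)⁻¹ • ∫ p in Icc (-π) π ×ˢ Icc (-π) π, F p‖ ≤ 2 * π * K / L := by
  set G : (Fin 2 → ℝ) → E := fun q => F (q 0, q 1) with hG
  have hGlip : LipschitzOnWith K G (Set.pi Set.univ fun _ : Fin 2 => Set.Icc (0 : ℝ) (2 * π)) := by
    refine LipschitzOnWith.of_dist_le_mul fun q _ q' _ => ?_
    rw [dist_eq_norm]
    refine (hlip (q 0, q 1) (q' 0, q' 1)).trans (mul_le_mul_of_nonneg_left ?_ K.2)
    rw [Prod.dist_eq]
    exact max_le (dist_le_pi_dist q q' 0) (dist_le_pi_dist q q' 1)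
  have h := norm_momentumAverage_sub_integral_le_div (L := L) hGlip
  rw [klfl_integral_brillouin_eq_prod F, klfl_setIntegral_shift_eq hF h1 h2] at h
  exact h

/-- **… against the planar integral of the square restriction**: if moreover `F = h` on the closed square and `h = 0` off it, then
`‖L⁻²·Σ_k F(2πk/L) − (2π)⁻²·∫_{ℝ²} h‖ ≤ 2πK/L`. -/
theorem klfl_latticeAverage_sub_planar_integral_norm_le {F h : ℝ × ℝ → E} (hF : Continuous F) (h1 : ∀ x y, F (x + 2 * π, y) = F (x, y))
    (h2 : ∀ x y, F (x, y + 2 * π) = F (x, y)) {K : ℝ≥0} (hlip : ∀ p q : ℝ × ℝ, ‖F p - F q‖ ≤ K * dist p q)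
    (hFh : ∀ p ∈ Icc (-π) π ×ˢ Icc (-π) π, F p = h p) (hh0 : ∀ p ∉ Icc (-π) π ×ˢ Icc (-π) π, h p = 0)
    (L : ℕ) [NeZero L] :
    ‖((L ^ 2 : ℕ) : ℝ)⁻¹ • ∑ k : TorusSite 2 L, F (latticeMomentum L k 0, latticeMomentum L k 1) -
        ((2 * π) ^ 2)⁻¹ • ∫ p, h p‖ ≤ 2 * π * K / L := by
  have hs : MeasurableSet (Icc (-π) π ×ˢ Icc (-π) π : Set (ℝ × ℝ)) := measurableSet_Icc.prod measurableSet_Icc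
  have heq : ∫ p in Icc (-π) π ×ˢ Icc (-π) π, F p = ∫ p, h p := by
    rw [setIntegral_congr_fun hs hFh]
    exact setIntegral_eq_integral_of_forall_compl_eq_zero fun p hp => hh0 p hp
  rw [← heq]
  exact klfl_latticeAverage_sub_integral_norm_le hF h1 h2 hlip L

end Summit.HubbardSuperconductivity.HubbardSuperconductivity.Theorems.KLRegimeSplit

end
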